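import Literature.Analysis.ValidatedNumerics.ParametricLyapunovCertificate
import Literature.Analysis.ValidatedNumerics.ParametricVertexCertificateInterval
import HarnessLib

/-!
# Piecewise-AFFINE Lyapunov certificates: `Re μ ≤ −r` on a box with a leaf-wise affine `P(p)`

Topic `Literature/Analysis/ValidatedNumerics`. Sequel of `ParametricLyapunovCertificate.lean` (the
S3 «Lyapunov shape» of the certnum eigen-margin call, design note
`run/shared/lean/pub/certnum/sdp/DESIGN-eigopt.md` §1 S3). There every kd-leaf carries ONE constant
Lyapunov matrix `P`; on boxes of LIGHTLY DAMPED families (small `Re μ` against large `‖∂J/∂p‖`) the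
admissible leaf width is proportional to the damping and the leaf count explodes (the seat's kit job
j265251 ran out of memory at `> 6 000` leaves on a 4-parameter swing-model box). Here every leaf
carries an AFFINE Lyapunov matrix in centred coordinates,
`P(δ) = P_c + Σ_{k<K} δ_k P^{(k)}`, `δ = p − c` (`c` the leaf centre, `|δ_k| ≤ w_k` the half-widths) —
the affine parameter-dependent Lyapunov functions of Gahinet–Apkarian–Chilali — and the Lyapunov form
`Q(δ) = −(J(c+δ)ᵀP(δ) + P(δ)J(c+δ))` is QUADRATIC in `δ`:
`Q(δ) = A₀ + Σ_k δ_k A^{(k)} + Σ_k Σ_l δ_k δ_l H^{(k,l)}` with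
`A₀ = −(J_cᵀP_c + P_cJ_c)`, `A^{(k)} = −(J_cᵀP^{(k)} + P^{(k)}J_c) − (J^{(k)ᵀ}P_c + P_cJ^{(k)})`,
`H^{(k,l)} = −(J^{(k)ᵀ}P^{(l)} + P^{(l)}J^{(k)})` (`J_c = J(c)`). The producer chooses `P^{(k)}` so that
`A^{(k)} ≈ 0` (one extra Lyapunov solve per parameter), leaving a purely second-order remainder, which
the checker bounds ENTRYWISE by the interval radius `Δ = Σ_k Σ_l w_k w_l |H^{(k,l)}|`; the affine part
plus this radius is exactly an affine INTERVAL family, certified at the `2^K` corners of the centred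
box by `checkVertexBundleI` (`ParametricVertexCertificateInterval.lean`). `P(δ) ≻ 0` and
`λ_max(P(δ)) ≤ π` on the leaf are plain vertex bundles of the affine families `P(δ)` and `−P(δ)`
(`ParametricVertexCertificate.lean`). Per point the conclusion is again
`Literature.LinearAlgebra.Matrix.re_le_neg_div_of_real_lyapunov_form_bounds`
(`P ≻ O`, `yᵀPy ≤ π yᵀy`, `m yᵀy ≤ −yᵀ(JᵀP + PJ)y` ⇒ `Re μ ≤ −m/(2π)`); the box-to-leaves step is
`KdCert.sound`; shifted (`J + s·1`) and balanced (`D J D⁻¹`) tables transfer to the original family as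
in the constant-`P` file. The statement certified is the SAME pointwise statement («every `J(p)`,
`p` in the box, has all eigenvalues with `Re μ ≤ −r`»); only the certificate format is new. Nothing
here is new mathematics; it is certificate plumbing.

## What is NOT certified

Anything off the box; stability of a time-VARYING or nonlinear system `ẋ = J(p(t))x` (pointwise
Hurwitz is NOT a common-Lyapunov / LDI statement, and an affine `P(p)` is NOT a parameter-dependent
Lyapunov function for moving parameters either); instability where the tree fails; any relation
between `J(p)` and a device it linearises (client's rider); the float computation proposing the data.

## References

* [GahinetApkarianChilali1996] P. Gahinet, P. Apkarian, M. Chilali, Affine parameter-dependent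
  Lyapunov functions and real parametric uncertainty, IEEE Trans. Automat. Control 41 (1996) 436–442,
  §III — affine `P(p) = P₀ + Σ p_k P_k` for an affine family `A(p)` and the quadratic-in-`p` Lyapunov
  derivative (there controlled by multiconvexity; here by an interval remainder).
  [cite: GahinetApkarianChilali1996, §III]
* [CarlsonSchneider1962] D. Carlson, H. Schneider, J. Math. Anal. Appl. 6 (1963) 430–446, § 1 — the
  identity at an eigenvector, as packaged in `LyapunovDecayRate.lean`. [cite: CarlsonSchneider1962, § 1]
* [Hladik2017] M. Hladík, arXiv:1704.05782 (2017), Thm. 7 and §3 — vertex property of affine (interval)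
  symmetric families, as packaged in `ParametricVertexCertificate(Interval).lean`.
  [cite: Hladik2017, Thm. 7 and §3]
-/

open Finset Matrix

namespace Literature.Analysis.ValidatedNumerics

open ParametricIntervalPosSemidef ParametricEigenMargin

/-! ### Data and checker -/

/-- Entrywise sum of two rational tables on the `n × n` block. [folklore] -/
def addTab (n : ℕ) (A B : List (List ℚ)) : List (List ℚ) :=
  mtab n n fun i j ↦ mget A i j + mget B i j

/-- The centre of the first `K` coordinates of a box, as a list. [folklore] -/
def boxCentreList (K : ℕ) (B : Box) : List ℚ := vtab K fun k ↦ ((B.ivl k).1 + (B.ivl k).2) / 2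

/-- The half-widths of the first `K` coordinates of a box, as a list. [folklore] -/
def boxHalfList (K : ℕ) (B : Box) : List ℚ := vtab K fun k ↦ ((B.ivl k).2 - (B.ivl k).1) / 2

/-- The negated half-widths (lower ends of the centred box `[−w, w]`). [folklore] -/
def boxNegHalfList (K : ℕ) (B : Box) : List ℚ := vtab K fun k ↦ -(((B.ivl k).2 - (B.ivl k).1) / 2)

/-- Entrywise negation of each of `K` tables. [folklore] -/
def negTabs (n K : ℕ) (Ps : List (List (List ℚ))) : List (List (List ℚ)) :=
  vtab K fun k ↦ negTab n (Ps.getD k [])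

/-- The AFFINE-PART tables of the Lyapunov form in centred coordinates:
`A₀ = −(J_cᵀP_c + P_cJ_c)` and `A^{(k)} = −(J_cᵀP^{(k)} + P^{(k)}J_c) − (J^{(k)ᵀ}P_c + P_cJ^{(k)})`.
[cite: GahinetApkarianChilali1996, §III (the Lyapunov derivative of an affine `P(θ)`)] -/
def lyapAffTabs (n K : ℕ) (Jc : List (List ℚ)) (Js : List (List (List ℚ))) (Pc : List (List ℚ))
    (Ps : List (List (List ℚ))) : List (List ℚ) × List (List (List ℚ)) :=
  (lyapTab n Jc Pc,
    vtab K fun k ↦ addTab n (lyapTab n Jc (Ps.getD k [])) (lyapTab n (Js.getD k []) Pc))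

/-- The `K × K` second-order tables `H^{(k,l)} = −(J^{(k)ᵀ}P^{(l)} + P^{(l)}J^{(k)})` (tabulated once).
[cite: GahinetApkarianChilali1996, §III (the quadratic term of the Lyapunov derivative)] -/
def lyapCrossTabs (n K : ℕ) (Js Ps : List (List (List ℚ))) : List (List (List (List ℚ))) :=
  vtab K fun k ↦ vtab K fun l ↦ lyapTab n (Js.getD k []) (Ps.getD l [])

/-- The REMAINDER RADIUS table `Δ_{ij} = Σ_k Σ_l w_k w_l |H^{(k,l)}_{ij}|` for half-widths `w`: an
entrywise bound of `Σ_k Σ_l δ_k δ_l H^{(k,l)}` on the centred box `|δ_k| ≤ w_k`.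
[cite: Hladik2017, §3 (interval coefficients)] -/
def lyapAffRadTab (n K : ℕ) (Js Ps : List (List (List ℚ))) (w : List ℚ) : List (List ℚ) :=
  let X := lyapCrossTabs n K Js Ps
  mtab n n fun i j ↦ rsum K fun k ↦ rsum K fun l ↦
    vget w k * vget w l * |mget ((X.getD k []).getD l []) i j|

/-- An affine-Lyapunov leaf: the centre matrix `P_c`, the first-order tables `P^{(k)}` (centred
coordinates), a bound `π`, a vertex bundle `vP` for `P(δ) ⪰ vP.lam·1` (`vP.lam > 0`), a vertex bundle
`vN` for `−P(δ) ⪰ vN.lam·1` (`vN.lam ≥ −π`) and an interval vertex bundle `vb` for the Lyapunov form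
(claim `m = vb.lam`), all on the centred leaf box `[−w, w]`.
[cite: GahinetApkarianChilali1996, §III] -/
structure LyapAffLeaf where
  /-- the Lyapunov matrix at the leaf centre (rational, symmetric) -/
  P : List (List ℚ)
  /-- the first-order tables `P^{(k)}`, `k < K` (rational, symmetric) -/
  Ps : List (List (List ℚ))
  /-- claimed upper bound of `λ_max(P(δ))` on the leaf -/
  π : ℚ
  /-- vertex bundle of `P(δ)` on `[−w, w]` (need `vP.lam > 0`) -/
  vP : VertexBundle
  /-- vertex bundle of `−P(δ)` on `[−w, w]` (need `vN.lam ≥ −π`) -/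
  vN : VertexBundle
  /-- interval vertex bundle of the Lyapunov form on `[−w, w]` (claim `vb.lam`) -/
  vb : VertexBundle
  deriving Inhabited

/-- **The affine-Lyapunov leaf check** for the rate claim `r` on the leaf box `B`: with
`w`/`−w` the half-widths, `c` the centre and `J_c = J₀ + Σ c_k J^{(k)}` (exact): `0 < vP.lam` and the
vertex bundle of `(P_c, P^{(k)})` checks on `[−w, w]`; `0 < π`, `−π ≤ vN.lam` and the vertex bundle of
`(−P_c, −P^{(k)})` checks; `0 ≤ vb.lam`, `2·π·r ≤ vb.lam`, and the INTERVAL vertex bundle of the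
affine-part tables with constant radius `Δ` (no parameter radii) checks on `[−w, w]`.
[cite: GahinetApkarianChilali1996, §III; Hladik2017, Thm. 7 and §3] -/
def lyapAffLeafOK (n K : ℕ) (J0 : List (List ℚ)) (Js : List (List (List ℚ))) (r : ℚ) (B : Box)
    (l : LyapAffLeaf) : Bool :=
  let w := boxHalfList K B
  let lo := boxNegHalfList K B
  let T := lyapAffTabs n K (affineAtQ n K J0 Js (boxCentreList K B)) Js l.P l.Ps
  decide (0 < l.vP.lam) && checkVertexBundle n K l.P l.Ps lo w l.vP &&
    decide (0 < l.π) && decide (-l.π ≤ l.vN.lam) &&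
    checkVertexBundle n K (negTab n l.P) (negTabs n K l.Ps) lo w l.vN &&
    decide (0 ≤ l.vb.lam) && decide (2 * l.π * r ≤ l.vb.lam) &&
    checkVertexBundleI n K T.1 T.2 (lyapAffRadTab n K Js l.Ps w) [] lo w l.vb

/-! ### Plumbing: tables as real matrices -/

/-- Entries of `finMat` (plumbing). [folklore] -/
private theorem finMat_apply₅ (n : ℕ) (A : List (List ℚ)) (i j : Fin n) :
    finMat n A i j = mreal A i j := rfl

/-- `(vtab K f).getD k d = f k` for `k < K`. [folklore] -/
private theorem vtab_getD {β : Type*} {K : ℕ} (f : ℕ → β) (d : β) {k : ℕ} (hk : k < K) :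
    (vtab K f).getD k d = f k := by
  unfold vtab
  rw [List.getD_eq_getElem (l := (List.range K).map f) (d := d) (by simp [hk]),
    List.getElem_map, List.getElem_range]

/-- `vreal (vtab K f) k = f k` for `k < K`. [folklore] -/
private theorem vreal_vtab {K : ℕ} (f : ℕ → ℚ) {k : ℕ} (hk : k < K) :
    vreal (vtab K f) k = ((f k : ℚ) : ℝ) := by
  unfold vreal; rw [vget_vtab f hk]

/-- `finMat (A + B) = finMat A + finMat B`. [folklore] -/
private theorem finMat_addTab (n : ℕ) (A B : List (List ℚ)) :
    finMat n (addTab n A B) = finMat n A + finMat n B := by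
  ext i j
  rw [Matrix.add_apply, finMat_apply₅, finMat_apply₅, finMat_apply₅]
  unfold addTab mreal
  rw [mget_mtab _ i.isLt j.isLt]; push_cast; rfl

/-- `finMat (−A) = −finMat A`. [folklore] -/
private theorem finMat_negTab₅ (n : ℕ) (A : List (List ℚ)) : finMat n (negTab n A) = -finMat n A := by
  ext i j
  rw [Matrix.neg_apply, finMat_apply₅, finMat_apply₅]
  unfold negTab mreal
  rw [mget_mtab _ i.isLt j.isLt]; push_cast; ring

/-- The real Lyapunov form matrix `−(JᵀP + PJ)` (bilinear in `(J, P)`). [cite: CarlsonSchneider1962, § 1] -/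
private def lyapRm {n : ℕ} (J P : Matrix (Fin n) (Fin n) ℝ) : Matrix (Fin n) (Fin n) ℝ := -(Jᵀ * P + P * J)

/-- `finMat (lyapTab J P) = −((finMat J)ᵀ · finMat P + finMat P · finMat J)`. [folklore] -/
private theorem finMat_lyapTab₅ {n : ℕ} (J P : List (List ℚ)) :
    finMat n (lyapTab n J P) = lyapRm (finMat n J) (finMat n P) := by
  ext i j
  unfold lyapRm
  rw [Matrix.neg_apply, Matrix.add_apply, Matrix.mul_apply, Matrix.mul_apply, finMat_apply₅]
  unfold lyapTab mreal
  rw [mget_mtab _ i.isLt j.isLt, rsum_eq_sum]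
  push_cast
  rw [← Fin.sum_univ_eq_sum_range (fun l ↦ ((mget J l i : ℚ) : ℝ) * ((mget P l j : ℚ) : ℝ)
    + ((mget P i l : ℚ) : ℝ) * ((mget J l j : ℚ) : ℝ)) n, Finset.sum_add_distrib]
  rfl

/-- `lyapRm` is affine in `J`. [folklore] -/
private theorem lyapRm_affine_left {n K : ℕ} (J0 : Matrix (Fin n) (Fin n) ℝ)
    (Jf : Fin K → Matrix (Fin n) (Fin n) ℝ) (P : Matrix (Fin n) (Fin n) ℝ) (p : Fin K → ℝ) :
    lyapRm (J0 + paramMatrix Jf p) P = lyapRm J0 P + paramMatrix (fun k ↦ lyapRm (Jf k) P) p := by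
  unfold lyapRm paramMatrix
  rw [Matrix.transpose_add, Matrix.transpose_sum, Matrix.add_mul, Matrix.sum_mul, Matrix.mul_add,
    Matrix.mul_sum]
  simp only [Matrix.transpose_smul, Matrix.smul_mul, Matrix.mul_smul, smul_neg, smul_add, neg_add,
    Finset.sum_add_distrib, Finset.sum_neg_distrib]
  abel

/-- `lyapRm` is affine in `P`. [folklore] -/
private theorem lyapRm_affine_right {n K : ℕ} (J : Matrix (Fin n) (Fin n) ℝ)
    (P0 : Matrix (Fin n) (Fin n) ℝ) (Pf : Fin K → Matrix (Fin n) (Fin n) ℝ) (p : Fin K → ℝ) :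
    lyapRm J (P0 + paramMatrix Pf p) = lyapRm J P0 + paramMatrix (fun k ↦ lyapRm J (Pf k)) p := by
  unfold lyapRm paramMatrix
  rw [Matrix.mul_add, Matrix.mul_sum, Matrix.add_mul, Matrix.sum_mul]
  simp only [Matrix.smul_mul, Matrix.mul_smul, smul_neg, smul_add, neg_add,
    Finset.sum_add_distrib, Finset.sum_neg_distrib]
  abel

/-- `paramMatrix` of a sum of families. [folklore] -/
private theorem paramMatrix_add_fun {n K : ℕ} (F G : Fin K → Matrix (Fin n) (Fin n) ℝ)
    (p : Fin K → ℝ) : paramMatrix (fun k ↦ F k + G k) p = paramMatrix F p + paramMatrix G p := by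
  unfold paramMatrix
  simp only [smul_add, Finset.sum_add_distrib]

/-- Nested `paramMatrix` = a double sum. [folklore] -/
private theorem paramMatrix_paramMatrix {n K : ℕ} (H : Fin K → Fin K → Matrix (Fin n) (Fin n) ℝ)
    (p : Fin K → ℝ) :
    paramMatrix (fun k ↦ paramMatrix (H k) p) p = ∑ k, ∑ l, (p k * p l) • H k l := by
  unfold paramMatrix
  simp only [Finset.smul_sum, smul_smul]

/-- **The quadratic expansion of the Lyapunov form** for affine `J` and affine `P`:
`Q(δ) = Q(J_c, P_c) + Σ_k δ_k (Q(J_c, P^{(k)}) + Q(J^{(k)}, P_c)) + Σ_k Σ_l δ_k δ_l Q(J^{(k)}, P^{(l)})`.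
[cite: GahinetApkarianChilali1996, §III (Lyapunov derivative of an affine `P(θ)`, quadratic in `θ`)] -/
private theorem lyapRm_expand {n K : ℕ} (Jc Pc : Matrix (Fin n) (Fin n) ℝ)
    (Jf Pf : Fin K → Matrix (Fin n) (Fin n) ℝ) (δ : Fin K → ℝ) :
    lyapRm (Jc + paramMatrix Jf δ) (Pc + paramMatrix Pf δ)
      = lyapRm Jc Pc + paramMatrix (fun k ↦ lyapRm Jc (Pf k) + lyapRm (Jf k) Pc) δ
        + ∑ k, ∑ l, (δ k * δ l) • lyapRm (Jf k) (Pf l) := by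
  rw [lyapRm_affine_left, lyapRm_affine_right]
  have h2 : (fun k ↦ lyapRm (Jf k) (Pc + paramMatrix Pf δ))
      = fun k ↦ lyapRm (Jf k) Pc + paramMatrix (fun l ↦ lyapRm (Jf k) (Pf l)) δ :=
    funext fun k ↦ lyapRm_affine_right _ _ _ _
  rw [h2, paramMatrix_add_fun, paramMatrix_add_fun, paramMatrix_paramMatrix]
  abel

/-- `paramMatrix` is additive in the parameter. [folklore] -/
private theorem paramMatrix_add_param {n K : ℕ} (A : Fin K → Matrix (Fin n) (Fin n) ℝ)
    (p q : Fin K → ℝ) : paramMatrix A (fun k ↦ p k + q k) = paramMatrix A p + paramMatrix A q := by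
  unfold paramMatrix
  simp only [add_smul, Finset.sum_add_distrib]

/-- The exact point table `affineAtQ` is the real affine family at the cast point. [folklore] -/
private theorem finMat_affineAtQ {n K : ℕ} (A0 : List (List ℚ)) (As : List (List (List ℚ)))
    (v : List ℚ) :
    finMat n (affineAtQ n K A0 As v)
      = finMat n A0 + paramMatrix (fun k : Fin K ↦ finMat n (As.getD k [])) (fun k : Fin K ↦ vreal v k) := by
  ext i j
  rw [Matrix.add_apply, paramMatrix_apply, finMat_apply₅, finMat_apply₅]
  unfold affineAtQ mreal
  rw [mget_mtab _ i.isLt j.isLt, rsum_eq_sum]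
  push_cast
  rw [← Fin.sum_univ_eq_sum_range (fun k ↦ ((vget v k : ℚ) : ℝ) * ((mget (As.getD k []) i j : ℚ) : ℝ)) K]
  rfl

/-- The negated tables are the negated affine family. [folklore] -/
private theorem affine_negTabs_eq {n K : ℕ} (P : List (List ℚ)) (Ps : List (List (List ℚ)))
    (δ : Fin K → ℝ) :
    finMat n (negTab n P) + paramMatrix (fun k : Fin K ↦ finMat n ((negTabs n K Ps).getD k [])) δ
      = -(finMat n P + paramMatrix (fun k : Fin K ↦ finMat n (Ps.getD k [])) δ) := by
  have h2 : ∀ k : Fin K, (negTabs n K Ps).getD k [] = negTab n (Ps.getD k []) :=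
    fun k ↦ vtab_getD _ _ k.isLt
  simp only [h2, finMat_negTab₅]
  unfold paramMatrix
  simp only [smul_neg, Finset.sum_neg_distrib, neg_add]

/-- The affine-part tables are the affine part of the expansion (real matrices).
[cite: GahinetApkarianChilali1996, §III] -/
private theorem affine_lyapAffTabs_eq {n K : ℕ} (Jc : List (List ℚ)) (Js : List (List (List ℚ)))
    (Pc : List (List ℚ)) (Ps : List (List (List ℚ))) (δ : Fin K → ℝ) :
    finMat n (lyapAffTabs n K Jc Js Pc Ps).1
        + paramMatrix (fun k : Fin K ↦ finMat n ((lyapAffTabs n K Jc Js Pc Ps).2.getD k [])) δ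
      = lyapRm (finMat n Jc) (finMat n Pc)
        + paramMatrix (fun k : Fin K ↦ lyapRm (finMat n Jc) (finMat n (Ps.getD k []))
            + lyapRm (finMat n (Js.getD k [])) (finMat n Pc)) δ := by
  have h1 : (lyapAffTabs n K Jc Js Pc Ps).1 = lyapTab n Jc Pc := rfl
  have h2 : ∀ k : Fin K, (lyapAffTabs n K Jc Js Pc Ps).2.getD k []
      = addTab n (lyapTab n Jc (Ps.getD k [])) (lyapTab n (Js.getD k []) Pc) :=
    fun k ↦ vtab_getD _ _ k.isLt
  simp only [h1, h2, finMat_addTab, finMat_lyapTab₅]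

/-- Entries of the cross tables. [folklore] -/
private theorem lyapCrossTabs_getD {n K : ℕ} (Js Ps : List (List (List ℚ))) {k l : ℕ}
    (hk : k < K) (hl : l < K) :
    ((lyapCrossTabs n K Js Ps).getD k []).getD l [] = lyapTab n (Js.getD k []) (Ps.getD l []) := by
  unfold lyapCrossTabs
  rw [vtab_getD _ _ hk, vtab_getD _ _ hl]

/-- The radius table read as reals: `Δ_{ij} = Σ_k Σ_l w_k w_l |H^{(k,l)}_{ij}|`. [cite: Hladik2017, §3] -/
private theorem mreal_lyapAffRadTab {n K : ℕ} (Js Ps : List (List (List ℚ))) (w : List ℚ)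
    (i j : Fin n) :
    mreal (lyapAffRadTab n K Js Ps w) i j
      = ∑ k : Fin K, ∑ l : Fin K, vreal w k * vreal w l
          * |lyapRm (finMat n (Js.getD k [])) (finMat n (Ps.getD l [])) i j| := by
  have e : ∀ k l : Fin K, (((mget (lyapTab n (Js.getD k []) (Ps.getD l [])) i j : ℚ)) : ℝ)
      = lyapRm (finMat n (Js.getD k [])) (finMat n (Ps.getD l [])) i j := fun k l ↦ by
    rw [← finMat_lyapTab₅]; rfl
  unfold lyapAffRadTab mreal
  rw [mget_mtab _ i.isLt j.isLt, rsum_eq_sum]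
  push_cast
  rw [← Fin.sum_univ_eq_sum_range (fun k ↦ ((rsum K fun l ↦
    vget w k * vget w l * |mget (((lyapCrossTabs n K Js Ps).getD k []).getD l []) i j| : ℚ) : ℝ)) K]
  refine Finset.sum_congr rfl fun k _ ↦ ?_
  rw [rsum_eq_sum]
  push_cast
  rw [← Fin.sum_univ_eq_sum_range (fun l ↦ ((vget w k : ℚ) : ℝ) * ((vget w l : ℚ) : ℝ)
    * |((mget (((lyapCrossTabs n K Js Ps).getD k []).getD l []) i j : ℚ) : ℝ)|) K]
  refine Finset.sum_congr rfl fun l _ ↦ ?_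
  rw [lyapCrossTabs_getD Js Ps k.isLt l.isLt, e k l]
  rfl

/-- Entries of a double sum of scaled matrices. [folklore] -/
private theorem sum_sum_smul_apply {n K : ℕ} (c : Fin K → Fin K → ℝ)
    (H : Fin K → Fin K → Matrix (Fin n) (Fin n) ℝ) (i j : Fin n) :
    (∑ k, ∑ l, c k l • H k l) i j = ∑ k, ∑ l, c k l * H k l i j := by
  simp only [Matrix.sum_apply, Matrix.smul_apply, smul_eq_mul]

/-- **The remainder bound**: on the centred box `|δ_k| ≤ w_k` every entry of the second-order term is
bounded by the radius table. [cite: Hladik2017, §3 (interval enclosure of the coefficients)] -/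
private theorem abs_remainder_le {n K : ℕ} {δ w : Fin K → ℝ} (hδ : ∀ k, |δ k| ≤ w k)
    (H : Fin K → Fin K → Matrix (Fin n) (Fin n) ℝ) (i j : Fin n) :
    |(∑ k, ∑ l, (δ k * δ l) • H k l) i j| ≤ ∑ k, ∑ l, w k * w l * |H k l i j| := by
  rw [sum_sum_smul_apply]
  refine (Finset.abs_sum_le_sum_abs _ _).trans (Finset.sum_le_sum fun k _ ↦ ?_)
  refine (Finset.abs_sum_le_sum_abs _ _).trans (Finset.sum_le_sum fun l _ ↦ ?_)
  rw [abs_mul, abs_mul]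
  have hw : ∀ m, 0 ≤ w m := fun m ↦ (abs_nonneg _).trans (hδ m)
  exact mul_le_mul (mul_le_mul (hδ k) (hδ l) (abs_nonneg _) (hw k)) le_rfl (abs_nonneg _)
    (mul_nonneg (hw k) (hw l))

/-! ### Soundness -/

/-- **Per leaf**: an accepted affine-Lyapunov leaf proves `Re μ ≤ −r` for every eigenvalue of `J(x)`
at every point `x` of the leaf box. [cite: GahinetApkarianChilali1996, §III; CarlsonSchneider1962, § 1;
Hladik2017, Thm. 7 and §3] -/
theorem re_le_neg_of_lyapAffLeafOK {n K : ℕ} {J0 : List (List ℚ)} {Js : List (List (List ℚ))} {r : ℚ}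
    {B : Box} {l : LyapAffLeaf} (h : lyapAffLeafOK n K J0 Js r B l = true) (x : ℕ → ℝ) (hx : B.mem x)
    {μ : ℂ} (hμ : μ ∈ spectrum ℂ ((finMat n J0
      + paramMatrix (fun k : Fin K ↦ finMat n (Js.getD k [])) (fun k : Fin K ↦ x k)).map (algebraMap ℝ ℂ))) :
    μ.re ≤ -(r : ℝ) := by
  unfold lyapAffLeafOK at h
  simp only [Bool.and_eq_true, decide_eq_true_eq] at h
  obtain ⟨⟨⟨⟨⟨⟨⟨hκ, hvP⟩, hπ⟩, hNπ⟩, hvN⟩, hlam0⟩, hrate⟩, hvb⟩ := h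
  -- centred coordinates
  set cL : List ℚ := boxCentreList K B with hcL
  set wL : List ℚ := boxHalfList K B with hwL
  set loL : List ℚ := boxNegHalfList K B with hloL
  let δ : Fin K → ℝ := fun k ↦ x k - vreal cL k
  have hc : ∀ k : Fin K, vreal cL k = ((((B.ivl k).1 + (B.ivl k).2) / 2 : ℚ) : ℝ) :=
    fun k ↦ vreal_vtab _ k.isLt
  have hw : ∀ k : Fin K, vreal wL k = ((((B.ivl k).2 - (B.ivl k).1) / 2 : ℚ) : ℝ) :=
    fun k ↦ vreal_vtab _ k.isLt
  have hlo : ∀ k : Fin K, vreal loL k = (((-(((B.ivl k).2 - (B.ivl k).1) / 2)) : ℚ) : ℝ) :=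
    fun k ↦ vreal_vtab _ k.isLt
  have hδmem : δ ∈ Set.Icc (fun k : Fin K ↦ vreal loL k) (fun k : Fin K ↦ vreal wL k) := by
    refine ⟨fun k ↦ ?_, fun k ↦ ?_⟩
    · show vreal loL k ≤ x k - vreal cL k
      rw [hlo, hc]; push_cast
      have := (hx k).1; have := (hx k).2; linarith
    · show x k - vreal cL k ≤ vreal wL k
      rw [hw, hc]; push_cast
      have := (hx k).1; have := (hx k).2; linarith
  have hδabs : ∀ k : Fin K, |δ k| ≤ vreal wL k := fun k ↦ by
    have h1 : vreal loL k ≤ δ k := hδmem.1 k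
    have h2 : δ k ≤ vreal wL k := hδmem.2 k
    rw [hlo k] at h1
    rw [hw k] at h2 ⊢
    push_cast at h1 h2 ⊢
    exact abs_le.2 ⟨by linarith, by linarith⟩
  have hxsplit : (fun k : Fin K ↦ x k) = fun k : Fin K ↦ vreal cL k + δ k :=
    funext fun k ↦ by show x k = vreal cL k + (x k - vreal cL k); ring
  -- the objects
  set J : Matrix (Fin n) (Fin n) ℝ :=
    finMat n J0 + paramMatrix (fun k : Fin K ↦ finMat n (Js.getD k [])) (fun k : Fin K ↦ x k) with hJ
  set Jc : Matrix (Fin n) (Fin n) ℝ := finMat n (affineAtQ n K J0 Js cL) with hJc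
  set P : Matrix (Fin n) (Fin n) ℝ :=
    finMat n l.P + paramMatrix (fun k : Fin K ↦ finMat n (l.Ps.getD k [])) δ with hPdef
  have hJsplit : J = Jc + paramMatrix (fun k : Fin K ↦ finMat n (Js.getD k [])) δ := by
    rw [hJ, hJc, finMat_affineAtQ, add_assoc, ← paramMatrix_add_param, ← hxsplit]
  -- P(δ) ≻ 0 on the leaf (vertex bundle of P)
  have hPpos : P.PosDef := posDef_affine_of_checkVertexBundle hvP hκ hδmem
  -- yᵀP(δ)y ≤ π yᵀy (vertex bundle of −P)
  have hPπ : ∀ y : Fin n → ℝ, y ⬝ᵥ (P *ᵥ y) ≤ (l.π : ℝ) * (y ⬝ᵥ y) := by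
    intro y
    have h1 := form_ge_on_box_of_checkVertexBundle hvN hδmem y
    rw [affine_negTabs_eq, Matrix.neg_mulVec, dotProduct_neg] at h1
    have hyy : 0 ≤ y ⬝ᵥ y := Finset.sum_nonneg fun i _ ↦ mul_self_nonneg (y i)
    have h2 : (-(l.π : ℝ)) * (y ⬝ᵥ y) ≤ (l.vN.lam : ℝ) * (y ⬝ᵥ y) :=
      mul_le_mul_of_nonneg_right (by exact_mod_cast hNπ) hyy
    linarith
  -- the Lyapunov form margin on the leaf (interval vertex bundle + remainder bound)
  have hQ : ∀ y : Fin n → ℝ, (l.vb.lam : ℝ) * (y ⬝ᵥ y) ≤ -(y ⬝ᵥ ((Jᵀ * P + P * J) *ᵥ y)) := by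
    intro y
    have hmem : ∀ i j : Fin n,
        |lyapRm J P i j - (finMat n (lyapAffTabs n K (affineAtQ n K J0 Js cL) Js l.P l.Ps).1
          + paramMatrix (fun k : Fin K ↦
              finMat n ((lyapAffTabs n K (affineAtQ n K J0 Js cL) Js l.P l.Ps).2.getD k [])) δ) i j|
        ≤ mreal (lyapAffRadTab n K Js l.Ps wL) i j
          + ∑ k : Fin K, |δ k| * mreal (([] : List (List (List ℚ))).getD k []) i j := by
      intro i j
      have hnil : ∀ k : Fin K, mreal (([] : List (List (List ℚ))).getD k []) i j = 0 := fun k ↦ by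
        simp [mreal, mget]
      simp only [hnil, mul_zero, Finset.sum_const_zero, add_zero]
      rw [affine_lyapAffTabs_eq, hJsplit, hPdef, hJc, lyapRm_expand, ← Matrix.sub_apply,
        add_sub_cancel_left, mreal_lyapAffRadTab]
      exact abs_remainder_le hδabs
        (fun k m ↦ lyapRm (finMat n (Js.getD k [])) (finMat n (l.Ps.getD m []))) i j
    have h1 := form_ge_interval_affine_of_checkVertexBundleI hvb hδmem hmem y
    unfold lyapRm at h1
    rw [Matrix.neg_mulVec, dotProduct_neg] at h1
    exact h1
  have hrate' : (r : ℝ) ≤ (l.vb.lam : ℝ) / (2 * (l.π : ℝ)) := by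
    rw [le_div_iff₀ (by positivity)]
    have : ((2 * l.π * r : ℚ) : ℝ) ≤ (l.vb.lam : ℝ) := by exact_mod_cast hrate
    push_cast at this; linarith
  have hmain := Literature.LinearAlgebra.Matrix.re_le_neg_div_of_real_lyapunov_form_bounds
    (J := J) (P := P) (by exact_mod_cast hlam0) (by exact_mod_cast hπ) hPpos hPπ hQ hμ
  rw [neg_div] at hmain
  linarith

/-- **Piecewise-affine Lyapunov certificate, box level (END-TO-END).** If a kd-tree of affine-Lyapunov
leaves passes `KdCert.check (lyapAffLeafOK n K J0 Js r)` on the box `B`, then for EVERY point `x` of `B`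
every complex eigenvalue `μ` of `J(x) = J₀ + Σ_k x_k J^{(k)}` satisfies `Re μ ≤ −r`.
[cite: GahinetApkarianChilali1996, §III; CarlsonSchneider1962, § 1; Hladik2017, Thm. 7 and §3] -/
theorem re_le_neg_of_kdCheck_lyapAff {n K : ℕ} {J0 : List (List ℚ)} {Js : List (List (List ℚ))}
    {r : ℚ} {B : Box} {t : KdCert LyapAffLeaf} (h : t.check (lyapAffLeafOK n K J0 Js r) B = true)
    (x : ℕ → ℝ) (hx : B.mem x) {μ : ℂ}
    (hμ : μ ∈ spectrum ℂ ((finMat n J0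
      + paramMatrix (fun k : Fin K ↦ finMat n (Js.getD k [])) (fun k : Fin K ↦ x k)).map (algebraMap ℝ ℂ))) :
    μ.re ≤ -(r : ℝ) :=
  KdCert.sound (P := fun x ↦ ∀ μ : ℂ, μ ∈ spectrum ℂ ((finMat n J0
      + paramMatrix (fun k : Fin K ↦ finMat n (Js.getD k [])) (fun k : Fin K ↦ x k)).map (algebraMap ℝ ℂ)) →
      μ.re ≤ -(r : ℝ))
    (fun _ _ hl x hx _ hμ ↦ re_le_neg_of_lyapAffLeafOK hl x hx hμ) t B h x hx μ hμ

/-- **Hurwitz on the whole box** from a piecewise-affine Lyapunov certificate with a positive rate.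
[cite: GahinetApkarianChilali1996, §III; CarlsonSchneider1962, § 1] -/
theorem forall_re_neg_of_kdCheck_lyapAff {n K : ℕ} {J0 : List (List ℚ)} {Js : List (List (List ℚ))}
    {r : ℚ} (hr : 0 < r) {B : Box} {t : KdCert LyapAffLeaf}
    (h : t.check (lyapAffLeafOK n K J0 Js r) B = true) (x : ℕ → ℝ) (hx : B.mem x) {μ : ℂ}
    (hμ : μ ∈ spectrum ℂ ((finMat n J0
      + paramMatrix (fun k : Fin K ↦ finMat n (Js.getD k [])) (fun k : Fin K ↦ x k)).map (algebraMap ℝ ℂ))) :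
    μ.re < 0 :=
  (re_le_neg_of_kdCheck_lyapAff h x hx hμ).trans_lt (by exact_mod_cast neg_neg_of_pos hr)

/-! ### Shifted and balanced tables (as in the constant-`P` file) -/

/-- `finMat (J + s·1) = finMat J + s • 1`. [folklore] -/
private theorem finMat_addDiagTab₅ (n : ℕ) (s : ℚ) (J : List (List ℚ)) :
    finMat n (addDiagTab n s J) = finMat n J + (s : ℝ) • (1 : Matrix (Fin n) (Fin n) ℝ) := by
  ext i j
  rw [Matrix.add_apply, Matrix.smul_apply, finMat_apply₅, finMat_apply₅, Matrix.one_apply, smul_eq_mul]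
  unfold addDiagTab mreal
  rw [mget_mtab _ i.isLt j.isLt]
  by_cases h : i = j
  · subst h; simp
  · have h' : (i : ℕ) ≠ (j : ℕ) := fun e ↦ h (Fin.ext e)
    simp [h, h']

/-- **Spectral shift**: if every eigenvalue of `M + s·1` has `Re ≤ −r` then every eigenvalue of `M` has
`Re ≤ −(s + r)`. [folklore] -/
private theorem re_le_neg_of_forall_shift {n : ℕ} {M : Matrix (Fin n) (Fin n) ℝ} {s r : ℚ}
    (h : ∀ ν : ℂ, ν ∈ spectrum ℂ ((M + (s : ℝ) • (1 : Matrix (Fin n) (Fin n) ℝ)).map (algebraMap ℝ ℂ)) →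
      ν.re ≤ -(r : ℝ))
    {μ : ℂ} (hμ : μ ∈ spectrum ℂ (M.map (algebraMap ℝ ℂ))) : μ.re ≤ -((s + r : ℚ) : ℝ) := by
  have hmap : (M + (s : ℝ) • (1 : Matrix (Fin n) (Fin n) ℝ)).map (algebraMap ℝ ℂ)
      = algebraMap ℂ (Matrix (Fin n) (Fin n) ℂ) (s : ℂ) + M.map (algebraMap ℝ ℂ) := by
    rw [Matrix.map_add (algebraMap ℝ ℂ) (map_add _), Algebra.algebraMap_eq_smul_one, add_comm]
    congr 1
    ext i j
    simp only [Matrix.map_apply, Matrix.smul_apply, Matrix.one_apply, smul_eq_mul, mul_ite, mul_one,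
      mul_zero]
    split_ifs <;> simp [Complex.coe_algebraMap]
  have hμ' : (s : ℂ) + μ ∈ spectrum ℂ ((M + (s : ℝ) • (1 : Matrix (Fin n) (Fin n) ℝ)).map (algebraMap ℝ ℂ)) := by
    rw [hmap, ← spectrum.singleton_add_eq]
    exact Set.add_mem_add (Set.mem_singleton _) hμ
  have h1 := h _ hμ'
  simp only [Complex.add_re, Complex.ratCast_re] at h1
  push_cast
  linarith

/-- **Shifted piecewise-affine Lyapunov certificate**: the kd-tree checks for the SHIFTED tables
`(J₀ + s·1, J^{(k)})` with rate `r` ⇒ every eigenvalue `μ` of the UNSHIFTED `J(x)`, `x` in the box,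
has `Re μ ≤ −(s + r)`. [cite: GahinetApkarianChilali1996, §III; CarlsonSchneider1962, § 1] -/
theorem re_le_neg_of_kdCheck_lyapAff_shifted {n K : ℕ} {J0 : List (List ℚ)}
    {Js : List (List (List ℚ))} {s r : ℚ} {B : Box} {t : KdCert LyapAffLeaf}
    (h : t.check (lyapAffLeafOK n K (addDiagTab n s J0) Js r) B = true) (x : ℕ → ℝ) (hx : B.mem x)
    {μ : ℂ} (hμ : μ ∈ spectrum ℂ ((finMat n J0
      + paramMatrix (fun k : Fin K ↦ finMat n (Js.getD k [])) (fun k : Fin K ↦ x k)).map (algebraMap ℝ ℂ))) :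
    μ.re ≤ -((s + r : ℚ) : ℝ) := by
  refine re_le_neg_of_forall_shift (fun ν hν ↦ re_le_neg_of_kdCheck_lyapAff h x hx ?_) hμ
  rw [finMat_addDiagTab₅]
  convert hν using 3
  abel

/-- `finMat (D·J·D⁻¹) = diag(d) · finMat J · diag(d⁻¹)` (real matrices). [folklore] -/
private theorem finMat_conjDiagTab₅ {n : ℕ} (d : List ℚ) (J : List (List ℚ)) :
    finMat n (conjDiagTab n d J)
      = Matrix.diagonal (fun i : Fin n ↦ (vreal d i)) * finMat n J
          * Matrix.diagonal (fun i : Fin n ↦ (vreal d i)⁻¹) := by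
  ext i j
  rw [Matrix.mul_diagonal, Matrix.diagonal_mul, finMat_apply₅, finMat_apply₅]
  unfold conjDiagTab mreal vreal
  rw [mget_mtab _ i.isLt j.isLt]; push_cast; ring

/-- The balanced affine family is the conjugate of the original one. [folklore] -/
private theorem affine_conjDiagTab_eq₅ {n K : ℕ} (d : List ℚ) (J0 : List (List ℚ))
    (Js : List (List (List ℚ))) (x : ℕ → ℝ) :
    finMat n (conjDiagTab n d J0)
        + paramMatrix (fun k : Fin K ↦ finMat n ((vtab K fun k ↦ conjDiagTab n d (Js.getD k [])).getD k []))
            (fun k : Fin K ↦ x k)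
      = Matrix.diagonal (fun i : Fin n ↦ (vreal d i))
          * (finMat n J0 + paramMatrix (fun k : Fin K ↦ finMat n (Js.getD k [])) (fun k : Fin K ↦ x k))
          * Matrix.diagonal (fun i : Fin n ↦ (vreal d i)⁻¹) := by
  have h2 : ∀ k : Fin K, (vtab K fun k ↦ conjDiagTab n d (Js.getD k [])).getD k []
      = conjDiagTab n d (Js.getD k []) := fun k ↦ vtab_getD _ _ k.isLt
  simp only [h2, finMat_conjDiagTab₅]
  unfold paramMatrix
  rw [Matrix.mul_add, Matrix.add_mul, Matrix.mul_sum, Matrix.sum_mul]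
  congr 1
  refine Finset.sum_congr rfl fun k _ ↦ ?_
  rw [Matrix.mul_smul, Matrix.smul_mul]

/-- **Positive diagonal similarity preserves the spectrum** (complexified real matrices): an
eigenvalue of `M` is an eigenvalue of `D M D⁻¹`. [folklore] -/
private theorem mem_spectrum_conjDiag {n : ℕ} {d : List ℚ} (hd : posListQ n d = true)
    {M : Matrix (Fin n) (Fin n) ℝ} {μ : ℂ} (hμ : μ ∈ spectrum ℂ (M.map (algebraMap ℝ ℂ))) :
    μ ∈ spectrum ℂ ((Matrix.diagonal (fun i : Fin n ↦ (vreal d i)) * M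
      * Matrix.diagonal (fun i : Fin n ↦ (vreal d i)⁻¹)).map (algebraMap ℝ ℂ)) := by
  have hdpos : ∀ i : Fin n, (0 : ℝ) < vreal d i := fun i ↦ by
    have := of_rall hd i.isLt; rw [decide_eq_true_eq] at this
    unfold vreal; exact_mod_cast this
  let dc : Fin n → ℂ := fun i ↦ ((vreal d i : ℝ) : ℂ)
  have hdc : ∀ i, dc i ≠ 0 := fun i ↦ by
    simp only [dc, ne_eq, Complex.ofReal_eq_zero]; exact (hdpos i).ne'
  let u : (Matrix (Fin n) (Fin n) ℂ)ˣ :=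
    ⟨Matrix.diagonal dc, Matrix.diagonal fun i ↦ (dc i)⁻¹,
      by rw [Matrix.diagonal_mul_diagonal]; convert Matrix.diagonal_one with i; exact mul_inv_cancel₀ (hdc i),
      by rw [Matrix.diagonal_mul_diagonal]; convert Matrix.diagonal_one with i; exact inv_mul_cancel₀ (hdc i)⟩
  have hconj : (Matrix.diagonal (fun i : Fin n ↦ (vreal d i)) * M
        * Matrix.diagonal (fun i : Fin n ↦ (vreal d i)⁻¹)).map (algebraMap ℝ ℂ)
      = (u : Matrix (Fin n) (Fin n) ℂ) * M.map (algebraMap ℝ ℂ) * (u⁻¹ : (Matrix (Fin n) (Fin n) ℂ)ˣ) := by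
    rw [Matrix.map_mul, Matrix.map_mul]
    have e1 : (Matrix.diagonal fun i : Fin n ↦ vreal d i).map (algebraMap ℝ ℂ) = Matrix.diagonal dc :=
      Matrix.diagonal_map (map_zero _)
    have e2 : (Matrix.diagonal fun i : Fin n ↦ (vreal d i)⁻¹).map (algebraMap ℝ ℂ)
        = Matrix.diagonal fun i ↦ (dc i)⁻¹ := by
      rw [Matrix.diagonal_map (map_zero _)]
      congr 1; funext i; simp [dc, Complex.coe_algebraMap]
    rw [e1, e2]; rfl
  rw [hconj, spectrum.units_conjugate]; exact hμ

/-- **Balanced + shifted piecewise-affine Lyapunov certificate ⇒ rate bound for the ORIGINAL family.**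
If all scaling factors are positive and the kd-tree checks for the tables
`(D J₀ D⁻¹ + s·1, D J^{(k)} D⁻¹)` with rate `r`, then every eigenvalue `μ` of `J(x)`, `x` in the box, has
`Re μ ≤ −(s + r)`. [cite: GahinetApkarianChilali1996, §III; CarlsonSchneider1962, § 1] -/
theorem re_le_neg_of_kdCheck_lyapAff_conj_shifted {n K : ℕ} {J0 : List (List ℚ)}
    {Js : List (List (List ℚ))} {d : List ℚ} {s r : ℚ} {B : Box} {t : KdCert LyapAffLeaf}
    (hd : posListQ n d = true)
    (h : t.check (lyapAffLeafOK n K (addDiagTab n s (conjDiagTab n d J0))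
      (vtab K fun k ↦ conjDiagTab n d (Js.getD k [])) r) B = true)
    (x : ℕ → ℝ) (hx : B.mem x) {μ : ℂ}
    (hμ : μ ∈ spectrum ℂ ((finMat n J0
      + paramMatrix (fun k : Fin K ↦ finMat n (Js.getD k [])) (fun k : Fin K ↦ x k)).map (algebraMap ℝ ℂ))) :
    μ.re ≤ -((s + r : ℚ) : ℝ) := by
  have hμ' := mem_spectrum_conjDiag hd hμ
  rw [← affine_conjDiagTab_eq₅ d J0 Js x] at hμ'
  exact re_le_neg_of_kdCheck_lyapAff_shifted h x hx hμ'

/-! ### Kernel example -/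

/-- `J(p) = [[−1, p], [0, −1]]`, `p ∈ [−1, 1]` (centre `0`, half-width `1`), ONE leaf with
`P_c = I`, `P^{(1)} = 0`, `π = 1`, rate `1/4`: `A₀ = 2·I`, `A^{(1)} = [[0, −1], [−1, 0]]`, no remainder
(`H = 0`); corner data `[[2, ∓1], [∓1, 2]] ± 0` pass Gershgorin with claim `1/2 = 2·π·r`; `P(δ) = I`
passes both plain bundles with empty factors. -/
example : KdCert.check (lyapAffLeafOK 2 1 [[-1, 0], [0, -1]] [[[0, 1], [0, 0]]] (1/4)) [((-1 : ℚ), 1)]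
    (KdCert.leaf ⟨[[1, 0], [0, 1]], [[[0, 0], [0, 0]]], 1,
      ⟨1, [⟨1, 0, [], []⟩, ⟨1, 0, [], []⟩]⟩, ⟨-1, [⟨-1, 0, [], []⟩, ⟨-1, 0, [], []⟩]⟩,
      ⟨1/2, [⟨1/2, 0, [], []⟩, ⟨1/2, 0, [], []⟩]⟩⟩) = true := by
  decide +kernel

/-! ### INTERVAL `J` tables (appended 2026-08-27, session 4): the family is only ENCLOSED

A client whose linearisation carries irrational or rounded data (load-flow sines / cosines, dyadic
roundings of high rational data) hands an affine CENTRE family `J(p) = J₀ + Σ p_k J^{(k)}` and a constant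
radii table `R ≥ 0` with the promise `|J′ᵢⱼ − J(p)ᵢⱼ| ≤ Rᵢⱼ` for the true matrix `J′` at `p`. Writing
`J′ = J(p) + E`, `|E| ≤ R`, the Lyapunov form picks up the extra term `−(EᵀP(δ) + P(δ)E)`, bounded
entrywise by `Σ_l (R_{li} P̄_{lj} + P̄_{il} R_{lj})` where `P̄ = |P_c| + Σ_k w_k |P^{(k)}| ≥ |P(δ)|` on the
leaf; the checker simply ADDS this table to the remainder radius `Δ` of the exact case. Everything else
(vertex bundles of `±P(δ)`, the interval vertex bundle, the rate lemma, kd / shift / balancing glue) is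
unchanged; the balanced radii are `D R D⁻¹` (entrywise `d_i R_{ij} / d_j ≥ 0`). Same POINTWISE statement,
now for EVERY member `J′` of the interval family at every `p` of the box. [cite: Hladik2017, §3] -/

/-- Entrywise bound `P̄ = |P_c| + Σ_{k<K} w_k |P^{(k)}|` of `|P(δ)|` on the centred leaf box `|δ_k| ≤ w_k`.
[cite: Hladik2017, §3 (interval coefficients)] -/
def absBoundTab (n K : ℕ) (P : List (List ℚ)) (Ps : List (List (List ℚ))) (w : List ℚ) : List (List ℚ) :=
  mtab n n fun i j ↦ |mget P i j| + rsum K fun k ↦ vget w k * |mget (Ps.getD k []) i j|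

/-- The radius of the `J`-enclosure term: `(Δ_J)_{ij} = Σ_l (R_{li} P̄_{lj} + P̄_{il} R_{lj}) ≥ |(EᵀP + PE)_{ij}|`
for `|E| ≤ R`, `|P| ≤ P̄`. [cite: Hladik2017, §3 (interval coefficients)] -/
def lyapRadJTab (n : ℕ) (R Pb : List (List ℚ)) : List (List ℚ) :=
  mtab n n fun i j ↦ rsum n fun l ↦ mget R l i * mget Pb l j + mget Pb i l * mget R l j

/-- **The affine-Lyapunov leaf check for an INTERVAL `J` family** (radii table `R ≥ 0`): as
`lyapAffLeafOK`, with the interval vertex bundle run on the radius `Δ + Δ_J`.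
[cite: GahinetApkarianChilali1996, §III; Hladik2017, Thm. 7 and §3] -/
def lyapAffLeafOKI (n K : ℕ) (J0 : List (List ℚ)) (Js : List (List (List ℚ))) (R : List (List ℚ)) (r : ℚ)
    (B : Box) (l : LyapAffLeaf) : Bool :=
  let w := boxHalfList K B
  let lo := boxNegHalfList K B
  let T := lyapAffTabs n K (affineAtQ n K J0 Js (boxCentreList K B)) Js l.P l.Ps
  nonnegQ n R && decide (0 < l.vP.lam) && checkVertexBundle n K l.P l.Ps lo w l.vP &&
    decide (0 < l.π) && decide (-l.π ≤ l.vN.lam) &&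
    checkVertexBundle n K (negTab n l.P) (negTabs n K l.Ps) lo w l.vN &&
    decide (0 ≤ l.vb.lam) && decide (2 * l.π * r ≤ l.vb.lam) &&
    checkVertexBundleI n K T.1 T.2
      (addTab n (lyapAffRadTab n K Js l.Ps w) (lyapRadJTab n R (absBoundTab n K l.P l.Ps w))) [] lo w l.vb

/-- `lyapRm` is additive in `J`. [folklore] -/
private theorem lyapRm_add_left {n : ℕ} (J E P : Matrix (Fin n) (Fin n) ℝ) :
    lyapRm (J + E) P = lyapRm J P + lyapRm E P := by
  unfold lyapRm
  rw [Matrix.transpose_add, Matrix.add_mul, Matrix.mul_add]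
  abel

/-- Entries of `addTab` as reals. [folklore] -/
private theorem mreal_addTab {n : ℕ} (A B : List (List ℚ)) (i j : Fin n) :
    mreal (addTab n A B) i j = mreal A i j + mreal B i j := by
  unfold addTab mreal; rw [mget_mtab _ i.isLt j.isLt]; push_cast; rfl

/-- Entries of `absBoundTab` as reals. [folklore] -/
private theorem mreal_absBoundTab {n K : ℕ} (P : List (List ℚ)) (Ps : List (List (List ℚ))) (w : List ℚ)
    (i j : Fin n) :
    mreal (absBoundTab n K P Ps w) i j
      = |mreal P i j| + ∑ k : Fin K, vreal w k * |mreal (Ps.getD k []) i j| := by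
  unfold absBoundTab mreal vreal
  rw [mget_mtab _ i.isLt j.isLt, rsum_eq_sum]
  push_cast
  rw [← Fin.sum_univ_eq_sum_range (fun k ↦ ((vget w k : ℚ) : ℝ) * |((mget (Ps.getD k []) i j : ℚ) : ℝ)|) K]

/-- Entries of `lyapRadJTab` as reals. [folklore] -/
private theorem mreal_lyapRadJTab {n : ℕ} (R Pb : List (List ℚ)) (i j : Fin n) :
    mreal (lyapRadJTab n R Pb) i j
      = ∑ l : Fin n, (mreal R l i * mreal Pb l j + mreal Pb i l * mreal R l j) := by
  unfold lyapRadJTab mreal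
  rw [mget_mtab _ i.isLt j.isLt, rsum_eq_sum]
  push_cast
  rw [← Fin.sum_univ_eq_sum_range (fun l ↦ ((mget R l i : ℚ) : ℝ) * ((mget Pb l j : ℚ) : ℝ)
    + ((mget Pb i l : ℚ) : ℝ) * ((mget R l j : ℚ) : ℝ)) n]

/-- `|P(δ)_{ab}| ≤ P̄_{ab}` on the centred leaf box. [cite: Hladik2017, §3] -/
private theorem abs_affine_le_absBoundTab {n K : ℕ} (P : List (List ℚ)) (Ps : List (List (List ℚ)))
    {δ : Fin K → ℝ} {w : List ℚ} (hδ : ∀ k : Fin K, |δ k| ≤ vreal w k) (a b : Fin n) :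
    |(finMat n P + paramMatrix (fun k : Fin K ↦ finMat n (Ps.getD k [])) δ) a b|
      ≤ mreal (absBoundTab n K P Ps w) a b := by
  rw [mreal_absBoundTab, Matrix.add_apply, paramMatrix_apply]
  refine (abs_add_le _ _).trans (add_le_add (le_of_eq rfl) ?_)
  refine (Finset.abs_sum_le_sum_abs _ _).trans (Finset.sum_le_sum fun k _ ↦ ?_)
  rw [abs_mul]
  exact mul_le_mul_of_nonneg_right (hδ k) (abs_nonneg _)

/-- **The `J`-enclosure remainder bound**: `|(−(EᵀP + PE))_{ij}| ≤ (Δ_J)_{ij}` for `|E| ≤ R`, `|P| ≤ P̄`.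
[cite: Hladik2017, §3 (interval coefficients)] -/
private theorem abs_lyapRm_le_lyapRadJTab {n : ℕ} {E P : Matrix (Fin n) (Fin n) ℝ} {R Pb : List (List ℚ)}
    (hE : ∀ a b : Fin n, |E a b| ≤ mreal R a b) (hP : ∀ a b : Fin n, |P a b| ≤ mreal Pb a b) (i j : Fin n) :
    |lyapRm E P i j| ≤ mreal (lyapRadJTab n R Pb) i j := by
  rw [mreal_lyapRadJTab]
  unfold lyapRm
  rw [Matrix.neg_apply, abs_neg, Matrix.add_apply, Matrix.mul_apply, Matrix.mul_apply,
    ← Finset.sum_add_distrib]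
  refine (Finset.abs_sum_le_sum_abs _ _).trans (Finset.sum_le_sum fun l _ ↦ ?_)
  rw [Matrix.transpose_apply]
  refine (abs_add_le _ _).trans (add_le_add ?_ ?_)
  · rw [abs_mul]; exact mul_le_mul (hE l i) (hP l j) (abs_nonneg _) ((abs_nonneg _).trans (hE l i))
  · rw [abs_mul]; exact mul_le_mul (hP i l) (hE l j) (abs_nonneg _) ((abs_nonneg _).trans (hP i l))

/-- **Per leaf, interval `J`**: an accepted leaf proves `Re μ ≤ −r` for every eigenvalue of every member
`J′` with `|J′ − J(x)| ≤ R` entrywise, at every point `x` of the leaf box.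
[cite: GahinetApkarianChilali1996, §III; CarlsonSchneider1962, § 1; Hladik2017, Thm. 7 and §3] -/
theorem re_le_neg_of_lyapAffLeafOKI {n K : ℕ} {J0 : List (List ℚ)} {Js : List (List (List ℚ))}
    {R : List (List ℚ)} {r : ℚ} {B : Box} {l : LyapAffLeaf} (h : lyapAffLeafOKI n K J0 Js R r B l = true)
    (x : ℕ → ℝ) (hx : B.mem x) {J' : Matrix (Fin n) (Fin n) ℝ}
    (hJ' : ∀ i j : Fin n, |J' i j - (finMat n J0
      + paramMatrix (fun k : Fin K ↦ finMat n (Js.getD k [])) (fun k : Fin K ↦ x k)) i j| ≤ mreal R i j)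
    {μ : ℂ} (hμ : μ ∈ spectrum ℂ (J'.map (algebraMap ℝ ℂ))) : μ.re ≤ -(r : ℝ) := by
  unfold lyapAffLeafOKI at h
  simp only [Bool.and_eq_true, decide_eq_true_eq] at h
  obtain ⟨⟨⟨⟨⟨⟨⟨⟨-, hκ⟩, hvP⟩, hπ⟩, hNπ⟩, hvN⟩, hlam0⟩, hrate⟩, hvb⟩ := h
  set cL : List ℚ := boxCentreList K B with hcL
  set wL : List ℚ := boxHalfList K B with hwL
  set loL : List ℚ := boxNegHalfList K B with hloL
  let δ : Fin K → ℝ := fun k ↦ x k - vreal cL k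
  have hc : ∀ k : Fin K, vreal cL k = ((((B.ivl k).1 + (B.ivl k).2) / 2 : ℚ) : ℝ) :=
    fun k ↦ vreal_vtab _ k.isLt
  have hw : ∀ k : Fin K, vreal wL k = ((((B.ivl k).2 - (B.ivl k).1) / 2 : ℚ) : ℝ) :=
    fun k ↦ vreal_vtab _ k.isLt
  have hlo : ∀ k : Fin K, vreal loL k = (((-(((B.ivl k).2 - (B.ivl k).1) / 2)) : ℚ) : ℝ) :=
    fun k ↦ vreal_vtab _ k.isLt
  have hδmem : δ ∈ Set.Icc (fun k : Fin K ↦ vreal loL k) (fun k : Fin K ↦ vreal wL k) := by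
    refine ⟨fun k ↦ ?_, fun k ↦ ?_⟩
    · show vreal loL k ≤ x k - vreal cL k
      rw [hlo, hc]; push_cast
      have := (hx k).1; have := (hx k).2; linarith
    · show x k - vreal cL k ≤ vreal wL k
      rw [hw, hc]; push_cast
      have := (hx k).1; have := (hx k).2; linarith
  have hδabs : ∀ k : Fin K, |δ k| ≤ vreal wL k := fun k ↦ by
    have h1 : vreal loL k ≤ δ k := hδmem.1 k
    have h2 : δ k ≤ vreal wL k := hδmem.2 k
    rw [hlo k] at h1
    rw [hw k] at h2 ⊢
    push_cast at h1 h2 ⊢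
    exact abs_le.2 ⟨by linarith, by linarith⟩
  have hxsplit : (fun k : Fin K ↦ x k) = fun k : Fin K ↦ vreal cL k + δ k :=
    funext fun k ↦ by show x k = vreal cL k + (x k - vreal cL k); ring
  -- the objects: centre family J, member J' = J + E
  set J : Matrix (Fin n) (Fin n) ℝ :=
    finMat n J0 + paramMatrix (fun k : Fin K ↦ finMat n (Js.getD k [])) (fun k : Fin K ↦ x k) with hJ
  set E : Matrix (Fin n) (Fin n) ℝ := J' - J with hE
  have hJ'split : J' = J + E := by rw [hE]; abel
  have hEabs : ∀ a b : Fin n, |E a b| ≤ mreal R a b := fun a b ↦ by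
    rw [hE, Matrix.sub_apply]; exact hJ' a b
  set Jc : Matrix (Fin n) (Fin n) ℝ := finMat n (affineAtQ n K J0 Js cL) with hJc
  set P : Matrix (Fin n) (Fin n) ℝ :=
    finMat n l.P + paramMatrix (fun k : Fin K ↦ finMat n (l.Ps.getD k [])) δ with hPdef
  have hJsplit : J = Jc + paramMatrix (fun k : Fin K ↦ finMat n (Js.getD k [])) δ := by
    rw [hJ, hJc, finMat_affineAtQ, add_assoc, ← paramMatrix_add_param, ← hxsplit]
  have hPabs : ∀ a b : Fin n, |P a b| ≤ mreal (absBoundTab n K l.P l.Ps wL) a b :=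
    fun a b ↦ abs_affine_le_absBoundTab l.P l.Ps hδabs a b
  have hPpos : P.PosDef := posDef_affine_of_checkVertexBundle hvP hκ hδmem
  have hPπ : ∀ y : Fin n → ℝ, y ⬝ᵥ (P *ᵥ y) ≤ (l.π : ℝ) * (y ⬝ᵥ y) := by
    intro y
    have h1 := form_ge_on_box_of_checkVertexBundle hvN hδmem y
    rw [affine_negTabs_eq, Matrix.neg_mulVec, dotProduct_neg] at h1
    have hyy : 0 ≤ y ⬝ᵥ y := Finset.sum_nonneg fun i _ ↦ mul_self_nonneg (y i)
    have h2 : (-(l.π : ℝ)) * (y ⬝ᵥ y) ≤ (l.vN.lam : ℝ) * (y ⬝ᵥ y) :=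
      mul_le_mul_of_nonneg_right (by exact_mod_cast hNπ) hyy
    linarith
  have hQ : ∀ y : Fin n → ℝ, (l.vb.lam : ℝ) * (y ⬝ᵥ y) ≤ -(y ⬝ᵥ ((J'ᵀ * P + P * J') *ᵥ y)) := by
    intro y
    have hmem : ∀ i j : Fin n,
        |lyapRm J' P i j - (finMat n (lyapAffTabs n K (affineAtQ n K J0 Js cL) Js l.P l.Ps).1
          + paramMatrix (fun k : Fin K ↦
              finMat n ((lyapAffTabs n K (affineAtQ n K J0 Js cL) Js l.P l.Ps).2.getD k [])) δ) i j|
        ≤ mreal (addTab n (lyapAffRadTab n K Js l.Ps wL) (lyapRadJTab n R (absBoundTab n K l.P l.Ps wL))) i j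
          + ∑ k : Fin K, |δ k| * mreal (([] : List (List (List ℚ))).getD k []) i j := by
      intro i j
      have hnil : ∀ k : Fin K, mreal (([] : List (List (List ℚ))).getD k []) i j = 0 := fun k ↦ by
        simp [mreal, mget]
      simp only [hnil, mul_zero, Finset.sum_const_zero, add_zero]
      -- (Aff + Rem + L(E)) − Aff = Rem + L(E) as matrices, then entrywise
      have key : lyapRm J' P - (finMat n (lyapAffTabs n K (affineAtQ n K J0 Js cL) Js l.P l.Ps).1
          + paramMatrix (fun k : Fin K ↦
              finMat n ((lyapAffTabs n K (affineAtQ n K J0 Js cL) Js l.P l.Ps).2.getD k [])) δ)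
          = (∑ k : Fin K, ∑ m : Fin K, (δ k * δ m) •
              lyapRm (finMat n (Js.getD k [])) (finMat n (l.Ps.getD m []))) + lyapRm E P := by
        rw [hJ'split, lyapRm_add_left, hJsplit, hJc, hPdef, affine_lyapAffTabs_eq, lyapRm_expand]
        abel
      rw [← Matrix.sub_apply, key, Matrix.add_apply, mreal_addTab, mreal_lyapAffRadTab]
      refine (abs_add_le _ _).trans (add_le_add ?_ ?_)
      · exact abs_remainder_le hδabs
          (fun k m ↦ lyapRm (finMat n (Js.getD k [])) (finMat n (l.Ps.getD m []))) i j
      · exact abs_lyapRm_le_lyapRadJTab hEabs hPabs i j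
    have h1 := form_ge_interval_affine_of_checkVertexBundleI hvb hδmem hmem y
    unfold lyapRm at h1
    rw [Matrix.neg_mulVec, dotProduct_neg] at h1
    exact h1
  have hmain := Literature.LinearAlgebra.Matrix.re_le_neg_div_of_real_lyapunov_form_bounds
    (J := J') (P := P) (by exact_mod_cast hlam0) (by exact_mod_cast hπ) hPpos hPπ hQ hμ
  have hrate' : (r : ℝ) ≤ (l.vb.lam : ℝ) / (2 * (l.π : ℝ)) := by
    rw [le_div_iff₀ (by positivity)]
    have : ((2 * l.π * r : ℚ) : ℝ) ≤ (l.vb.lam : ℝ) := by exact_mod_cast hrate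
    push_cast at this; linarith
  rw [neg_div] at hmain
  linarith

/-- **Interval-`J` piecewise-affine certificate, box level (END-TO-END).** If the kd-tree checks with
`lyapAffLeafOKI n K J0 Js R r` on `B`, then for every `x` of `B` and every real matrix `J′` with
`|J′ − J(x)| ≤ R` entrywise, every complex eigenvalue of `J′` has `Re μ ≤ −r`.
[cite: GahinetApkarianChilali1996, §III; CarlsonSchneider1962, § 1; Hladik2017, Thm. 7 and §3] -/
theorem re_le_neg_of_kdCheck_lyapAffI {n K : ℕ} {J0 : List (List ℚ)} {Js : List (List (List ℚ))}
    {R : List (List ℚ)} {r : ℚ} {B : Box} {t : KdCert LyapAffLeaf}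
    (h : t.check (lyapAffLeafOKI n K J0 Js R r) B = true) (x : ℕ → ℝ) (hx : B.mem x)
    {J' : Matrix (Fin n) (Fin n) ℝ}
    (hJ' : ∀ i j : Fin n, |J' i j - (finMat n J0
      + paramMatrix (fun k : Fin K ↦ finMat n (Js.getD k [])) (fun k : Fin K ↦ x k)) i j| ≤ mreal R i j)
    {μ : ℂ} (hμ : μ ∈ spectrum ℂ (J'.map (algebraMap ℝ ℂ))) : μ.re ≤ -(r : ℝ) :=
  KdCert.sound (P := fun x ↦ ∀ J' : Matrix (Fin n) (Fin n) ℝ, (∀ i j : Fin n, |J' i j - (finMat n J0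
      + paramMatrix (fun k : Fin K ↦ finMat n (Js.getD k [])) (fun k : Fin K ↦ x k)) i j| ≤ mreal R i j) →
      ∀ μ : ℂ, μ ∈ spectrum ℂ (J'.map (algebraMap ℝ ℂ)) → μ.re ≤ -(r : ℝ))
    (fun _ _ hl x hx _ hJ' _ hμ ↦ re_le_neg_of_lyapAffLeafOKI hl x hx hJ' hμ) t B h x hx J' hJ' μ hμ

/-- **Shifted interval-`J` certificate**: tables `(J₀ + s·1, J^{(k)})`, radii `R`, rate `r` ⇒ every
member `J′` at `x` has `Re μ ≤ −(s + r)` (`J′ + s·1` is a member of the shifted family with the same radii).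
[cite: GahinetApkarianChilali1996, §III; CarlsonSchneider1962, § 1] -/
theorem re_le_neg_of_kdCheck_lyapAffI_shifted {n K : ℕ} {J0 : List (List ℚ)}
    {Js : List (List (List ℚ))} {R : List (List ℚ)} {s r : ℚ} {B : Box} {t : KdCert LyapAffLeaf}
    (h : t.check (lyapAffLeafOKI n K (addDiagTab n s J0) Js R r) B = true) (x : ℕ → ℝ) (hx : B.mem x)
    {J' : Matrix (Fin n) (Fin n) ℝ}
    (hJ' : ∀ i j : Fin n, |J' i j - (finMat n J0
      + paramMatrix (fun k : Fin K ↦ finMat n (Js.getD k [])) (fun k : Fin K ↦ x k)) i j| ≤ mreal R i j)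
    {μ : ℂ} (hμ : μ ∈ spectrum ℂ (J'.map (algebraMap ℝ ℂ))) : μ.re ≤ -((s + r : ℚ) : ℝ) := by
  refine re_le_neg_of_forall_shift (fun ν hν ↦ re_le_neg_of_kdCheck_lyapAffI h x hx
    (J' := J' + (s : ℝ) • (1 : Matrix (Fin n) (Fin n) ℝ)) (fun i j ↦ ?_) hν) hμ
  rw [finMat_addDiagTab₅]
  have e : (J' + (s : ℝ) • (1 : Matrix (Fin n) (Fin n) ℝ)) i j
      - (finMat n J0 + (s : ℝ) • (1 : Matrix (Fin n) (Fin n) ℝ)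
        + paramMatrix (fun k : Fin K ↦ finMat n (Js.getD k [])) (fun k : Fin K ↦ x k)) i j
      = J' i j - (finMat n J0 + paramMatrix (fun k : Fin K ↦ finMat n (Js.getD k [])) (fun k : Fin K ↦ x k)) i j := by
    simp only [Matrix.add_apply, Matrix.smul_apply]; ring
  rw [e]; exact hJ' i j

/-- Radii of the balanced family: `|d_i E_{ij} / d_j| ≤ d_i R_{ij} / d_j`. [folklore] -/
private theorem abs_conj_le {n : ℕ} {d : List ℚ} (hd : posListQ n d = true) {E : Matrix (Fin n) (Fin n) ℝ}
    {R : List (List ℚ)} (hE : ∀ a b : Fin n, |E a b| ≤ mreal R a b) (i j : Fin n) :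
    |(Matrix.diagonal (fun i : Fin n ↦ (vreal d i)) * E * Matrix.diagonal (fun i : Fin n ↦ (vreal d i)⁻¹)) i j|
      ≤ mreal (conjDiagTab n d R) i j := by
  have hdpos : ∀ i : Fin n, (0 : ℝ) < vreal d i := fun i ↦ by
    have := of_rall hd i.isLt; rw [decide_eq_true_eq] at this
    unfold vreal; exact_mod_cast this
  rw [Matrix.mul_diagonal, Matrix.diagonal_mul, abs_mul, abs_mul, abs_of_pos (hdpos i),
    abs_of_pos (inv_pos.2 (hdpos j))]
  unfold conjDiagTab mreal
  rw [mget_mtab _ i.isLt j.isLt]; push_cast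
  rw [div_eq_mul_inv]
  have e : ((vget d i : ℚ) : ℝ) = vreal d i := rfl
  have e' : ((vget d j : ℚ) : ℝ) = vreal d j := rfl
  rw [e, e']
  exact mul_le_mul_of_nonneg_right (mul_le_mul_of_nonneg_left (hE i j) (hdpos i).le)
    (inv_pos.2 (hdpos j)).le

/-- **Balanced + shifted interval-`J` certificate ⇒ rate bound for every member of the ORIGINAL interval
family**: scaling factors positive and the kd-tree checks for `(D J₀ D⁻¹ + s·1, D J^{(k)} D⁻¹)` with the
balanced radii `D R D⁻¹` and rate `r` ⇒ every `J′` with `|J′ − J(x)| ≤ R`, `x` in the box, has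
`Re μ ≤ −(s + r)`. [cite: GahinetApkarianChilali1996, §III; CarlsonSchneider1962, § 1] -/
theorem re_le_neg_of_kdCheck_lyapAffI_conj_shifted {n K : ℕ} {J0 : List (List ℚ)}
    {Js : List (List (List ℚ))} {R : List (List ℚ)} {d : List ℚ} {s r : ℚ} {B : Box}
    {t : KdCert LyapAffLeaf} (hd : posListQ n d = true)
    (h : t.check (lyapAffLeafOKI n K (addDiagTab n s (conjDiagTab n d J0))
      (vtab K fun k ↦ conjDiagTab n d (Js.getD k [])) (conjDiagTab n d R) r) B = true)
    (x : ℕ → ℝ) (hx : B.mem x) {J' : Matrix (Fin n) (Fin n) ℝ}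
    (hJ' : ∀ i j : Fin n, |J' i j - (finMat n J0
      + paramMatrix (fun k : Fin K ↦ finMat n (Js.getD k [])) (fun k : Fin K ↦ x k)) i j| ≤ mreal R i j)
    {μ : ℂ} (hμ : μ ∈ spectrum ℂ (J'.map (algebraMap ℝ ℂ))) : μ.re ≤ -((s + r : ℚ) : ℝ) := by
  set M : Matrix (Fin n) (Fin n) ℝ :=
    finMat n J0 + paramMatrix (fun k : Fin K ↦ finMat n (Js.getD k [])) (fun k : Fin K ↦ x k) with hM
  have hμ' := mem_spectrum_conjDiag hd hμ
  refine re_le_neg_of_kdCheck_lyapAffI_shifted h x hx (fun i j ↦ ?_) hμ'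
  rw [affine_conjDiagTab_eq₅ d J0 Js x, ← hM, ← Matrix.sub_apply, ← Matrix.sub_mul, ← Matrix.mul_sub]
  exact abs_conj_le hd (E := J' - M) (fun a b ↦ by rw [Matrix.sub_apply]; exact hJ' a b) i j

/-! ### Kernel example (interval `J`) -/

/-- The example above with radii `R = [[1/10, 0], [0, 1/10]]`: `P̄ = I`, `Δ_J = (RᵀP̄ + P̄R) = (1/5)·I`,
so the corner data `[[2, ∓1], [∓1, 2]] ± 1/5` on the diagonal still pass Gershgorin with claim `1/2`
(`|∓1| + 1/5 ≤ 2 − 1/2`). -/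
example : KdCert.check (lyapAffLeafOKI 2 1 [[-1, 0], [0, -1]] [[[0, 1], [0, 0]]] [[1/10, 0], [0, 1/10]] (1/4))
    [((-1 : ℚ), 1)]
    (KdCert.leaf ⟨[[1, 0], [0, 1]], [[[0, 0], [0, 0]]], 1,
      ⟨1, [⟨1, 0, [], []⟩, ⟨1, 0, [], []⟩]⟩, ⟨-1, [⟨-1, 0, [], []⟩, ⟨-1, 0, [], []⟩]⟩,
      ⟨1/2, [⟨1/2, 0, [], []⟩, ⟨1/2, 0, [], []⟩]⟩⟩) = true := by
  decide +kernel

end Literature.Analysis.ValidatedNumerics
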